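import Literature.NumberTheory.QuadraticForms.UnitNormIndex
import HarnessLib

/-!
# O'Meara 65:10, arithmetic set-up (definitions): the `S`-units `𝔘` of a quadratic extension,
# their conjugation, `𝔲 ↪ 𝔘`, the torsion-free part `𝔲₁`, and `-1`

Definitions file for the proof of the named fact `unitNormIndex K` (O'Meara, *Introduction to
quadratic forms*, §65B Prop. 65:10) of `UnitNormIndex.lean` (namespace
`Literature.NumberTheory.QuadraticForms.OMeara65`): for a number field `K`, a finite set `T` of finite
places (`S = {v ∉ T}`) and an extension `E/K` of number fields,

* `sUnitsAbove K E T` — O'Meara's `𝔘`, the `S_E`-units of `E` (units at all places of `E` not above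
  `T`; Mathlib's `Set.unit` for `placesAbove K E T`), with its stability under `Aut(E/K)`
  (`map_mem_sUnitsAbove`) and the restricted automorphisms `conjSUnits T τ : 𝔘 ≃* 𝔘`;
* `sUnitsEmbedding E T : 𝔲 →* 𝔘` — the (injective) embedding of the `S`-units of `K`;
* `powSUnits E T ≤ 𝔘` — O'Meara's `𝔲₁` (step 2 of the proof: `𝔲 = 𝔲₀ × 𝔲₁`), realised as the image
  of `𝔲^m`, `m` the order of the torsion of `𝔲` (a torsion-free subgroup of finite index of `𝔲`,
  which is all the proof uses);
* `negOne E T` — the element `-1` of `𝔘`.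

The theorems about them (`𝔘^σ = 𝔲`, `N 𝔘 = N_{E/F} 𝔘`, ranks, `-1 = T(√a)`) are in the sibling
`UnitNormIndexSetup.lean`.

## References

* O. T. O'Meara, *Introduction to quadratic forms*, Grundlehren 117, Springer (1963), §65A (the
  diagram `N_{E/F} 𝔘 ⊆ 𝔲`), §65B Prop. 65:10 (proof, steps 1–2), PDF pp. 179–184 of the held copy.
-/

noncomputable section

open NumberField IsDedekindDomain Module
open scoped Valued

namespace Literature.NumberTheory.QuadraticForms.OMeara65

variable {K : Type} [Field K] [NumberField K]
variable {E : Type} [Field E] [NumberField E] [Algebra K E]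

/-! ### `𝔘` and the conjugation -/

section Conj

variable (K E) in
/-- O'Meara's `𝔘`: the `S_E`-units of `E`, i.e. the units at all finite places of `E` not above `T`
(Mathlib's `Set.unit` for `placesAbove K E T`). An abbreviation, to fix the ambient group `Eˣ`.
[cite: Omeara1963, §65A] -/
abbrev sUnitsAbove (T : Finset (HeightOneSpectrum (𝓞 K))) : Subgroup Eˣ :=
  (placesAbove K E T).unit E

omit [NumberField K] in
/-- Membership in `𝔘`: `u` is a unit at every place of `E` not above `T`. [folklore] -/
theorem mem_sUnitsAbove_iff {T : Finset (HeightOneSpectrum (𝓞 K))} {u : Eˣ} :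
    u ∈ sUnitsAbove K E T ↔ ∀ w : HeightOneSpectrum (𝓞 E), w ∉ placesAbove K E T →
      w.valuation E (u : E) = 1 :=
  Iff.rfl

/-- A place of `E` not above `T` stays so under a `K`-automorphism. [folklore] -/
theorem smul_notMem_placesAbove' {T : Finset (HeightOneSpectrum (𝓞 K))} {w : HeightOneSpectrum (𝓞 E)}
    (hw : w ∉ placesAbove K E T) (τ : E ≃ₐ[K] E) : τ • w ∉ placesAbove K E T := by
  rw [mem_placesAbove_iff, Automorphic.HeightOneSpectrum.under_algEquiv_smul]
  exact hw

/-- `σ u ∈ 𝔘` for `u ∈ 𝔘` (`|σ u|_w = |u|_{σ⁻¹ w}`). [cite: Omeara1963, §65B Prop. 65:10 (proof, step 1)] -/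
theorem map_mem_sUnitsAbove {T : Finset (HeightOneSpectrum (𝓞 K))} (τ : E ≃ₐ[K] E) {u : Eˣ}
    (hu : u ∈ sUnitsAbove K E T) : Units.map (τ : E →* E) u ∈ sUnitsAbove K E T := by
  intro w hw
  rw [Units.coe_map, MonoidHom.coe_coe]
  have h := Automorphic.HeightOneSpectrum.valuation_algEquiv_smul (σ := τ) (w := τ⁻¹ • w) (x := (u : E))
  rw [smul_inv_smul] at h
  rw [h]
  exact hu _ (smul_notMem_placesAbove' hw τ⁻¹)

/-- The conjugation `σ` restricted to `𝔘`, an automorphism `𝔘 ≃* 𝔘` (inverse: `σ⁻¹` restricted).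
[cite: Omeara1963, §65B Prop. 65:10 (proof, step 1)] -/
def conjSUnits (T : Finset (HeightOneSpectrum (𝓞 K))) (τ : E ≃ₐ[K] E) :
    sUnitsAbove K E T ≃* sUnitsAbove K E T where
  toFun u := ⟨Units.map (τ : E →* E) u, map_mem_sUnitsAbove τ u.2⟩
  invFun u := ⟨Units.map (τ.symm : E →* E) u, map_mem_sUnitsAbove τ.symm u.2⟩
  left_inv u := by
    apply Subtype.ext; apply Units.ext
    simp [Units.coe_map]
  right_inv u := by
    apply Subtype.ext; apply Units.ext
    simp [Units.coe_map]
  map_mul' x y := by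
    apply Subtype.ext; apply Units.ext
    simp [Units.coe_map]

/-- `conjSUnits T τ u = τ u` on underlying elements. [folklore] -/
@[simp]
theorem coe_conjSUnits {T : Finset (HeightOneSpectrum (𝓞 K))} (τ : E ≃ₐ[K] E) (u : sUnitsAbove K E T) :
    (((conjSUnits T τ u : sUnitsAbove K E T) : Eˣ) : E) = τ ((u : Eˣ) : E) := rfl

/-- `conjSUnits` of an involution is an involution. [folklore] -/
theorem conjSUnits_conjSUnits {T : Finset (HeightOneSpectrum (𝓞 K))} {τ : E ≃ₐ[K] E}
    (hτ : τ * τ = 1) (u : sUnitsAbove K E T) : conjSUnits T τ (conjSUnits T τ u) = u := by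
  apply Subtype.ext
  apply Units.ext
  rw [coe_conjSUnits, coe_conjSUnits, ← AlgEquiv.mul_apply, hτ, AlgEquiv.one_apply]

end Conj

/-! ### `𝔲 ↪ 𝔘` and `𝔘^σ = 𝔲` -/

section Fixed

/-- An `S`-unit of `K` is an `S_E`-unit of `E`: `|r|_w = |r|_v ^ e(w|v) = 1` for `w ∣ v ∉ T`.
[cite: Omeara1963, §65A] -/
theorem unitsMap_algebraMap_mem_sUnitsAbove {T : Finset (HeightOneSpectrum (𝓞 K))} {r : Kˣ}
    (hr : r ∈ ((↑T : Set (HeightOneSpectrum (𝓞 K))).unit K)) :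
    Units.map (algebraMap K E : K →* E) r ∈ sUnitsAbove K E T := by
  intro w hw
  rw [Units.coe_map, MonoidHom.coe_coe,
    valuation_algebraMap_of_mem_finitePlacesOver (mem_finitePlacesOver_iff.2 rfl) (r : K),
    hr _ (by simpa [mem_placesAbove_iff] using hw), one_pow]

variable (E) in
/-- The embedding `𝔲 ↪ 𝔘`, `r ↦ r · 1_E`, as a homomorphism `↥𝔲 →* ↥𝔘`. [cite: Omeara1963, §65A] -/
def sUnitsEmbedding (T : Finset (HeightOneSpectrum (𝓞 K))) :
    ((↑T : Set (HeightOneSpectrum (𝓞 K))).unit K) →* sUnitsAbove K E T where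
  toFun r := ⟨Units.map (algebraMap K E : K →* E) r, unitsMap_algebraMap_mem_sUnitsAbove r.2⟩
  map_one' := Subtype.ext (map_one _)
  map_mul' _ _ := Subtype.ext (map_mul _ _ _)

/-- Underlying element of `sUnitsEmbedding E T r`. [folklore] -/
@[simp]
theorem coe_sUnitsEmbedding {T : Finset (HeightOneSpectrum (𝓞 K))}
    (r : ((↑T : Set (HeightOneSpectrum (𝓞 K))).unit K)) :
    (((sUnitsEmbedding E T r : sUnitsAbove K E T) : Eˣ) : E) = algebraMap K E ((r : Kˣ) : K) := rfl

/-- `sUnitsEmbedding` is injective. [folklore] -/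
theorem sUnitsEmbedding_injective (T : Finset (HeightOneSpectrum (𝓞 K))) :
    Function.Injective (sUnitsEmbedding E T) := fun x y h ↦ by
  apply Subtype.ext; apply Units.ext
  exact (algebraMap K E).injective (by simpa using congrArg (fun z : sUnitsAbove K E T ↦ ((z : Eˣ) : E)) h)

end Fixed

/-! ### The torsion-free part `𝔲₁ = 𝔲^m` of `𝔲` -/

section PowSUnits

variable (E) in
/-- O'Meara's `𝔲₁` (step 2: `𝔲 = 𝔲₀ × 𝔲₁` with `𝔲₀` finite, `𝔲₁` free of rank `s - 1`), realised as
`𝔲^m ↪ 𝔘` for `m` the order of the torsion subgroup of `𝔲`: a torsion-free subgroup of finite index of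
`𝔲`, which is all the proof uses. [cite: Omeara1963, §65B Prop. 65:10 (proof, step 2)] -/
def powSUnits (T : Finset (HeightOneSpectrum (𝓞 K))) : Subgroup (sUnitsAbove K E T) :=
  ((powMonoidHom (Nat.card (CommGroup.torsion ((↑T : Set (HeightOneSpectrum (𝓞 K))).unit K))) :
      ((↑T : Set (HeightOneSpectrum (𝓞 K))).unit K) →* _).range).map (sUnitsEmbedding E T)

end PowSUnits

/-! ### `-1 = T(√a)` and the elements of square `1` -/

section MinusOne

omit [NumberField K] in
/-- `-1 ∈ 𝔘`. [folklore] -/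
theorem neg_one_mem_sUnitsAbove (T : Finset (HeightOneSpectrum (𝓞 K))) : (-1 : Eˣ) ∈ sUnitsAbove K E T :=
  fun w _ ↦ by rw [Units.val_neg, Units.val_one, Valuation.map_neg, Valuation.map_one]

variable (E) in
/-- The element `ε = -1` of `𝔘`. [folklore] -/
def negOne (T : Finset (HeightOneSpectrum (𝓞 K))) : sUnitsAbove K E T := ⟨-1, neg_one_mem_sUnitsAbove T⟩

end MinusOne

end Literature.NumberTheory.QuadraticForms.OMeara65
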